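import Summits.PneNP.PneNP.Theses.PlantedClique
import Literature.Probability.RandomGraphs.PlantedCliqueProgramFP
import Literature.Probability.RandomGraphs.PlantedCliqueProgramMatrix
import Literature.Computability.Complexity.CanonicalCodes
import Literature.Computability.Complexity.ClayProblemProofs
import Literature.Computability.Complexity.RandomizedProofs
import Literature.Computability.Complexity.PRelHierarchy
import Literature.Computability.Complexity.StringCopy
import Literature.Computability.Complexity.CodeFPModArith

/-!
# Route PlantedClique — `Assembly2` (stmt-PneNP-8690)

`ErdosRenyiNoLargeClique → (Wave0-NP ⊆ Wave0-P) → ¬ PlantedcliqueDetectionHard`. Under `NP ⊆ P` (bridges `P_bool_eq_holds`,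
`NP_bool_eq_holds`) the clique language `L = {⟨1ⁿ, w⟩ : the graph read off w by AKSProg.adj has a clique of size t(n)}`,
`t(n) = 3·|bin n|`, is in `NP` (BY DEFINITION of `polyExists`: certificate = the vertex list, verifier = the typed
`CodeFP` test "length `t(n)`, entries `< n`, duplicate-free, pairwise adjacent" on the canonicalised certificate), hence in
`P`; its indicator `χ ∈ FP` makes `T := RandAlg.ofDet χ` a PPT test (`IsPolyTime.ofDet_holds`). Type I:
`typeIError T n = Pr[ω(G(n,1/2)) ≥ t(n)] → 0` by `ErdosRenyiNoLargeClique` (`t(n) ≥ 3 log₂ n`); type II: the planted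
`⌈n^{1/4}⌉`-clique contains a `t(n)`-clique for all large `n`, so `typeIIError T k n = 0` eventually. Hence the error sum
tends to `0`, contradicting `PlantedcliqueDetectionHard` at `ε = 1/4`.
-/

set_option linter.dupNamespace false -- `Summit.PneNP.PneNP.…`: summit = sub-problem name (D-0017 single-conjunct layout)

namespace Summit.PneNP.PneNP.Theorems

open _root_.Computability Polynomial Filter
open Literature.Computability.Complexity Literature.Computability.Complexity.CodeFP
  Literature.Computability.Complexity.Brick
open Literature.Probability.RandomGraphs.PlantedClique

/-- `n ↦ |bin n|` from the unary numeral, in polynomial time (convert to binary, measure the string). [folklore] -/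
theorem plantedClique_codeFP_sizeOfUn : CodeFP unE natE fun n : ℕ => (natE n).length := by
  obtain ⟨F₁, h₁, e₁⟩ := (natOfUn : CodeFP unE natE id)
  obtain ⟨F₂, h₂, e₂⟩ := (natOfUn.comp strLength : CodeFP strE natE fun w : List Bool => id w.length)
  refine CodeFP.of_fn (F₂ ∘ F₁) (comp_mem_FP h₂ h₁) fun n => ?_
  rw [Function.comp_apply, e₁]
  exact e₂ (natE n)

/-- **The clique test** on `((n, w), C)`: `|C| = 3|bin n|`, every entry `< n`, no duplicates, and all pairs of distinct
entries adjacent in the graph read off `w` (`AKSProg.isClique`); polynomial time on codes. [cite: Karp1972, §3 (CLIQUE)] [folklore] -/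
theorem plantedClique_codeFP_cliqueTest :
    CodeFP (pairE (pairE unE strE) (listE natE)) bitE fun t : (ℕ × List Bool) × List ℕ =>
      decide (t.2.length = 3 * (natE t.1.1).length) && (t.2.all (fun a => decide (a < t.1.1)) &&
        (decide t.2.Nodup && AKSProg.isClique t.1.1 t.1.2 t.2)) := by
  have hnu : CodeFP (pairE (pairE unE strE) (listE natE)) unE fun t : (ℕ × List Bool) × List ℕ => t.1.1 :=
    (CodeFP.fst _ _).fst'
  have hn : CodeFP (pairE (pairE unE strE) (listE natE)) natE fun t : (ℕ × List Bool) × List ℕ => t.1.1 :=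
    (natOfUn.comp hnu :)
  have hC : CodeFP (pairE (pairE unE strE) (listE natE)) (rawE natE) fun t : (ℕ × List Bool) × List ℕ => t.2 :=
    ((rawOfList natE).comp (CodeFP.snd _ _) :)
  have h1 : CodeFP (pairE (pairE unE strE) (listE natE)) bitE fun t : (ℕ × List Bool) × List ℕ =>
      decide (t.2.length = 3 * (natE t.1.1).length) :=
    (natEq.comp (((natLength natE).comp hC).pair (natMul.comp ((CodeFP.const _ 3).pair
      (plantedClique_codeFP_sizeOfUn.comp hnu)))) :)
  have h2 : CodeFP (pairE (pairE unE strE) (listE natE)) bitE fun t : (ℕ × List Bool) × List ℕ =>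
      t.2.all (fun a => decide (a < t.1.1)) :=
    ((CodeFP.all (σ := ℕ) (eσ := natE) (natLt.comp ((CodeFP.snd natE natE).pair (CodeFP.fst natE natE)) :)).comp
      (hn.pair hC) :)
  have h3 : CodeFP (pairE (pairE unE strE) (listE natE)) bitE fun t : (ℕ × List Bool) × List ℕ => decide t.2.Nodup :=
    ((CodeFP.nodup natE_injective).comp hC :)
  have h4 : CodeFP (pairE (pairE unE strE) (listE natE)) bitE fun t : (ℕ × List Bool) × List ℕ =>
      AKSProg.isClique t.1.1 t.1.2 t.2 := (AKSProg.isClique_codeFP.comp ((CodeFP.fst _ _).pair hC) :)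
  exact h1.and (h2.and (h3.and h4))

/-- Length of a raw list code of numerals below `n`: at most `|l| · (2|bin n| + 2)`. [folklore] -/
theorem plantedClique_length_rawE_le (n : ℕ) : ∀ l : List ℕ, (∀ a ∈ l, a < n) →
    (rawE natE l).length ≤ l.length * (2 * (natE n).length + 2)
  | [], _ => by simp
  | a :: l, h => by
    rw [rawE_cons, length_boolPair, List.length_cons]
    have ha : (natE a).length ≤ (natE n).length := length_natE_mono (h a (List.mem_cons_self ..)).le
    have hl := plantedClique_length_rawE_le n l fun b hb => h b (List.mem_cons_of_mem _ hb)
    nlinarith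

/-- **The clique language is in `NP` and means what it should on genuine inputs**: some `L ∈ NP` with
`⟨1ⁿ, encodeEdgeVec x⟩ ∈ L ↔ graphOfEdgeVec x` has a clique with `3|bin n|` vertices. Membership in `NP` is by the
definition `NP = ∃ᵖ·P` (verifier = canonicalise the certificate, run the clique test; bound `2X²`). [cite: Karp1972, §3 (CLIQUE ∈ NP)] [folklore] -/
theorem plantedClique_exists_cliqueLang :
    ∃ L : Language Bool, L ∈ Nondeterministic.NP ∧ ∀ (n : ℕ) (x : EdgeVec n),
      boolPair (unaryEncodeNat n) (encodeEdgeVec x) ∈ L ↔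
        ∃ S : Finset (Fin n), S.card = 3 * (natE n).length ∧ (graphOfEdgeVec x).IsClique (S : Set (Fin n)) := by
  obtain ⟨f, hf, hfQ⟩ := plantedClique_codeFP_cliqueTest
  set V : Language Bool := (f ∘ fanoutFn fstF (CanonCode.canonListFnC 2 canonF ∘ sndF)) ⁻¹' PRelSigma.HeadIs true
    with hVdef
  have hV : V ∈ Classes.P :=
    preimage_mem_P (PRelSigma.HeadIs_mem_P true) (comp_mem_FP hf (fanoutFn_mem_FP fstF_mem_FP
      (comp_mem_FP (CanonCode.canonListFnC_mem_FP 2 canonF_mem_FP) sndF_mem_FP)))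
  -- decoding / re-encoding of certificates
  have hcan : ∀ y : List Bool,
      encodingNatBool.listBool.decode y =
          some (NegCNF.decList decodeNat (boolUnpair y).1.length (boolUnpair y).2) ∧
        CanonCode.canonListFnC 2 canonF y =
          encodingNatBool.listBool.encode (NegCNF.decList decodeNat (boolUnpair y).1.length (boolUnpair y).2) :=
    fun y => CanonCode.canonListFnC_eq encodingNatBool decodeNat (fun _ => rfl) canonF_eq_encodeNat_decodeNat
      (A := 1) (B := 1) (fun u => by have := length_canonF_le u; omega) (by norm_num) y
  -- the verifier on genuine instances
  have hVsem : ∀ (n : ℕ) (w y : List Bool),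
      boolPair (boolPair (unaryEncodeNat n) w) y ∈ V ↔
        (decide ((NegCNF.decList decodeNat (boolUnpair y).1.length (boolUnpair y).2).length = 3 * (natE n).length) &&
          ((NegCNF.decList decodeNat (boolUnpair y).1.length (boolUnpair y).2).all (fun a => decide (a < n)) &&
            (decide (NegCNF.decList decodeNat (boolUnpair y).1.length (boolUnpair y).2).Nodup &&
              AKSProg.isClique n w (NegCNF.decList decodeNat (boolUnpair y).1.length (boolUnpair y).2)))) = true := by
    intro n w y
    set D := NegCNF.decList decodeNat (boolUnpair y).1.length (boolUnpair y).2 with hD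
    change (f ∘ fanoutFn fstF (CanonCode.canonListFnC 2 canonF ∘ sndF)) (boolPair (boolPair (unaryEncodeNat n) w) y) ∈
      PRelSigma.HeadIs true ↔ _
    simp only [Function.comp_apply, fanoutFn_apply, fstF_boolPair, sndF_boolPair, PRelSigma.mem_HeadIs]
    rw [(hcan y).2, listE_eq, ← hD,
      show boolPair (boolPair (unaryEncodeNat n) w) (listE encodingNatBool.encode D) =
        pairE (pairE unE strE) (listE natE) ((n, w), D) from rfl, hfQ]
    simp [bitE]
  refine ⟨{z | ∃ y : List Bool, y.length ≤ (2 * X ^ 2 : Polynomial ℕ).eval z.length ∧ boolPair z y ∈ V},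
    ⟨V, hV, 2 * X ^ 2, fun z => Iff.rfl⟩, fun n x => ?_⟩
  constructor
  · rintro ⟨y, -, hy⟩
    rw [hVsem] at hy
    simp only [Bool.and_eq_true, decide_eq_true_eq, List.all_eq_true] at hy
    obtain ⟨hlen, hall, hnd, hcl⟩ := hy
    set D := NegCNF.decList decodeNat (boolUnpair y).1.length (boolUnpair y).2 with hD
    have hallD : ∀ m ∈ D.toFinset, m < n := fun m hm => hall m (List.mem_toFinset.1 hm)
    refine ⟨D.toFinset.attachFin hallD, ?_, ?_⟩
    · rw [Finset.card_attachFin, List.toFinset_card_of_nodup hnd, hlen]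
    · intro u hu v hv huv
      rw [Finset.mem_coe, Finset.mem_attachFin, List.mem_toFinset] at hu hv
      have huv' : (u : ℕ) ≠ v := fun h => huv (Fin.ext h)
      rcases (AKSProg.isClique_eq_true_iff _ _ _).1 hcl u hu v hv with h | h
      · exact absurd h huv'
      · exact (AKSProg.adj_encodeEdgeVec x u v).1 h
  · rintro ⟨S, hcard, hcl⟩
    set D : List ℕ := S.toList.map Fin.val with hD
    have hDmem : ∀ {a : ℕ}, a ∈ D ↔ ∃ u ∈ S, (u : ℕ) = a := fun {a} => by
      simp [hD]
    have hDlen : D.length = 3 * (natE n).length := by rw [hD, List.length_map, Finset.length_toList, hcard]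
    have hDlt : ∀ a ∈ D, a < n := fun a ha => by
      obtain ⟨u, -, rfl⟩ := hDmem.1 ha
      exact u.isLt
    have hDnd : D.Nodup := (Finset.nodup_toList S).map Fin.val_injective
    have hDcl : AKSProg.isClique n (encodeEdgeVec x) D = true := by
      rw [AKSProg.isClique_eq_true_iff]
      intro a ha b hb
      obtain ⟨u, hu, rfl⟩ := hDmem.1 ha
      obtain ⟨v, hv, rfl⟩ := hDmem.1 hb
      by_cases huv : u = v
      · exact Or.inl (by rw [huv])
      · exact Or.inr ((AKSProg.adj_encodeEdgeVec x u v).2 (hcl (Finset.mem_coe.2 hu) (Finset.mem_coe.2 hv) huv))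
    refine ⟨encodingNatBool.listBool.encode D, ?_, ?_⟩
    · -- the certificate is short: `|code D| ≤ 6|bin n|² + 12|bin n| + 2 ≤ 2 (2n+2)²`
      have h3 : 2 * n + 2 ≤ (boolPair (unaryEncodeNat n) (encodeEdgeVec x)).length := by
        rw [length_boolPair, show (unaryEncodeNat n).length = n from unary_decode_encode_nat n]; omega
      have key : (encodingNatBool.listBool.encode D).length ≤ 2 * (2 * n + 2) ^ 2 := by
        rw [listE_eq, show listE encodingNatBool.encode D = boolPair (unE D.length) (rawE natE D) from rfl,
          length_boolPair, show (unE D.length).length = D.length from unary_decode_encode_nat _]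
        have h1 := plantedClique_length_rawE_le n D hDlt
        have h2 : (natE n).length ≤ n := length_natE_le n
        set s := (natE n).length
        rw [hDlen] at h1 ⊢
        nlinarith
      rw [eval_mul, eval_pow, eval_X, eval_ofNat]
      exact key.trans (Nat.mul_le_mul_left 2 (Nat.pow_le_pow_left h3 2))
    · rw [hVsem]
      have hdec : NegCNF.decList decodeNat (boolUnpair (encodingNatBool.listBool.encode D)).1.length
          (boolUnpair (encodingNatBool.listBool.encode D)).2 = D := by
        have h := (hcan (encodingNatBool.listBool.encode D)).1
        rw [encodingNatBool.listBool.decode_encode] at h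
        exact (Option.some.inj h).symm
      rw [hdec]
      simp only [Bool.and_eq_true, decide_eq_true_eq, List.all_eq_true]
      exact ⟨hDlen, fun a ha => hDlt a ha, hDnd, hDcl⟩

/-- Acceptance probability of a DETERMINISTIC test: the mass of the accepted graphs. [folklore] -/
theorem plantedClique_acceptProbOn_ofDet (χ : List Bool → Bool) {n : ℕ} (D : PMF (EdgeVec n)) :
    acceptProbOn (RandAlg.ofDet χ) D =
      (D.toOuterMeasure {G | χ (boolPair (unaryEncodeNat n) (encodeEdgeVec G)) = true}).toReal := by
  unfold acceptProbOn
  simp only [RandAlg.outputPMF_ofDet]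
  rw [show (D.bind fun G => PMF.pure (χ (boolPair (unaryEncodeNat n) (encodeEdgeVec G)))) =
      D.map (fun G => χ (boolPair (unaryEncodeNat n) (encodeEdgeVec G))) from rfl, PMF.toOuterMeasure_map_apply]
  rfl

/-- **The clique size `3|bin n|` beats `3 log₂ n`** (so the first-moment bound applies with `η = 1`). [folklore] -/
theorem plantedClique_three_logb_le (n : ℕ) : (2 + 1) * Real.logb 2 (n : ℝ) ≤ ((3 * (natE n).length : ℕ) : ℝ) := by
  rcases Nat.eq_zero_or_pos n with rfl | hn
  · simp
  · have hlt : Real.logb 2 (n : ℝ) < (natE n).length := by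
      have h := lt_two_pow_length_natE n
      have h' : (n : ℝ) < (2 : ℝ) ^ ((natE n).length : ℝ) := by
        rw [Real.rpow_natCast]; exact_mod_cast h
      calc Real.logb 2 (n : ℝ) < Real.logb 2 ((2 : ℝ) ^ ((natE n).length : ℝ)) :=
            Real.logb_lt_logb one_lt_two (by exact_mod_cast hn) h'
        _ = (natE n).length := Real.logb_rpow two_pos (by norm_num)
    push_cast
    linarith

/-- **Eventually `3|bin n| ≤ ⌈n^{1/4}⌉` and `≤ n`** (`|bin n| ≤ log₂ n + 1` and `log n = o(n^{1/4})`). [folklore] -/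
theorem plantedClique_eventually_size_le :
    ∀ᶠ n : ℕ in atTop, 3 * (natE n).length ≤ ⌈(n : ℝ) ^ (1 / 2 - 1 / 4 : ℝ)⌉₊ ∧ 3 * (natE n).length ≤ n := by
  have hlo := (isLittleO_log_rpow_atTop (by norm_num : (0 : ℝ) < 1 / 4)).comp_tendsto tendsto_natCast_atTop_atTop
  have hev := hlo.def (by positivity : (0 : ℝ) < Real.log 2 / 6)
  filter_upwards [hev, eventually_ge_atTop (6 ^ 4)] with n hlog h64
  have hn1 : 1 ≤ n := le_trans (by norm_num) h64
  have hnpos : (0 : ℝ) < n := by exact_mod_cast hn1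
  -- `|bin n| ≤ log₂ n + 1`
  have hsize : ((natE n).length : ℝ) ≤ Real.logb 2 n + 1 := by
    have h1 : (natE n).length ≤ Nat.log 2 n + 1 := length_natE_le_of_lt (Nat.lt_pow_succ_log_self one_lt_two n)
    have h2 : ((Nat.log 2 n : ℕ) : ℝ) ≤ Real.logb 2 n := by
      rw [Real.le_logb_iff_rpow_le one_lt_two hnpos, Real.rpow_natCast]
      exact_mod_cast Nat.pow_log_le_self 2 (by omega)
    calc ((natE n).length : ℝ) ≤ ((Nat.log 2 n + 1 : ℕ) : ℝ) := by exact_mod_cast h1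
      _ = (Nat.log 2 n : ℝ) + 1 := by push_cast; ring
      _ ≤ Real.logb 2 n + 1 := by linarith
  -- `log n ≤ (log 2 / 6) n^{1/4}`
  have hlog' : Real.log n ≤ Real.log 2 / 6 * (n : ℝ) ^ (1 / 4 : ℝ) := by
    have h := hlog
    simp only [Function.comp_apply, Real.norm_eq_abs] at h
    rw [abs_of_nonneg (Real.log_nonneg (by exact_mod_cast hn1)), abs_of_nonneg (by positivity)] at h
    exact h
  have hlog2 : 0 < Real.log 2 := Real.log_pos one_lt_two
  have hlogb : Real.logb 2 n ≤ (n : ℝ) ^ (1 / 4 : ℝ) / 6 := by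
    rw [Real.logb, div_le_iff₀ hlog2]
    nlinarith
  -- `6 ≤ n^{1/4}`
  have h6 : (6 : ℝ) ≤ (n : ℝ) ^ (1 / 4 : ℝ) := by
    have h : ((6 : ℝ) ^ (4 : ℕ)) ^ (1 / 4 : ℝ) ≤ (n : ℝ) ^ (1 / 4 : ℝ) :=
      Real.rpow_le_rpow (by positivity) (by exact_mod_cast h64) (by norm_num)
    rwa [← Real.rpow_natCast_mul (by norm_num : (0 : ℝ) ≤ 6), show ((4 : ℕ) : ℝ) * (1 / 4) = 1 by norm_num,
      Real.rpow_one] at h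
  have hmain : ((3 * (natE n).length : ℕ) : ℝ) ≤ (n : ℝ) ^ (1 / 2 - 1 / 4 : ℝ) := by
    rw [show (1 / 2 - 1 / 4 : ℝ) = 1 / 4 by norm_num]
    push_cast
    nlinarith
  refine ⟨?_, ?_⟩
  · exact_mod_cast hmain.trans (Nat.le_ceil _)
  · have hle : (n : ℝ) ^ (1 / 2 - 1 / 4 : ℝ) ≤ n := by
      conv_rhs => rw [← Real.rpow_one (n : ℝ)]
      exact Real.rpow_le_rpow_of_exponent_le (by exact_mod_cast hn1) (by norm_num)
    exact_mod_cast hmain.trans hle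

/-- **Assembly 2 of route PlantedClique (stmt-PneNP-8690)**: `ErdosRenyiNoLargeClique → (Wave0-NP ⊆ Wave0-P) →
¬ PlantedcliqueDetectionHard` — under `NP ⊆ P` the deterministic polynomial-time test "is there a clique of size `3|bin n|`?"
has type-I error `→ 0` (first-moment bound) and type-II error `0` eventually (the planted `⌈n^{1/4}⌉`-clique), contradicting
detection hardness at `ε = 1/4`. [cite: Karp1972, §3] [cite: BarakHopkinsKelnerKothariMoitraPotechin2019, §1 Remark 2] -/
theorem plantedClique_assembly2_proof : Summit.PneNP.PneNP.Theses.PlantedClique.Assembly2 := by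
  intro hE hall hD
  -- `NP ⊆ P`
  have hsub : Nondeterministic.NP ⊆ Classes.P := by
    intro L hL
    rw [← show PNPWave0.NP Bool = Nondeterministic.NP from NP_bool_eq_holds] at hL
    have := hall L hL
    rwa [show PNPWave0.P Bool = Classes.P from P_bool_eq_holds] at this
  obtain ⟨L, hLNP, hLsem⟩ := plantedClique_exists_cliqueLang
  have hLP : L ∈ Classes.P := hsub hLNP
  -- the deterministic test
  set χ : List Bool → Bool := fun z => L.boolIndicator z with hχ
  have hχFP : (fun z => encodeBool (χ z)) ∈ FP := indicatorFn_mem_FP hLP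
  set T : RandAlg (List Bool) Bool := RandAlg.ofDet χ with hT
  have hTpoly : T.IsPolyTime id (fun b => [b]) := RandAlg.IsPolyTime.ofDet_holds (by exact hχFP)
  have hevent : ∀ (n : ℕ), {G : EdgeVec n | χ (boolPair (unaryEncodeNat n) (encodeEdgeVec G)) = true} =
      {G | ∃ S : Finset (Fin n), S.card = 3 * (natE n).length ∧ (graphOfEdgeVec G).IsClique (S : Set (Fin n))} := by
    intro n
    ext G
    simp only [Set.mem_setOf_eq, hχ]
    rw [← hLsem n G]
    exact (Set.mem_iff_boolIndicator _ _).symm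
  -- type I: first-moment bound
  have h1 : Tendsto (fun n => typeIError T n) atTop (nhds 0) := by
    have hER := hE (fun n => 3 * (natE n).length) ⟨1, one_pos, Eventually.of_forall plantedClique_three_logb_le⟩
    have h := (ENNReal.tendsto_toReal ENNReal.zero_ne_top).comp hER
    rw [ENNReal.toReal_zero] at h
    refine h.congr fun n => ?_
    simp only [Function.comp_apply, typeIError, hT, plantedClique_acceptProbOn_ofDet, hevent n]
  -- type II: the planted clique is found, eventually surely
  have h2 : ∀ᶠ n : ℕ in atTop, typeIIError T (fun n => ⌈(n : ℝ) ^ (1 / 2 - 1 / 4 : ℝ)⌉₊) n = 0 := by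
    filter_upwards [plantedClique_eventually_size_le] with n hn
    obtain ⟨hk, hnn⟩ := hn
    rw [typeIIError, hT, plantedClique_acceptProbOn_ofDet, hevent n, sub_eq_zero, eq_comm, ENNReal.toReal_eq_one_iff,
      plantedCliqueDist, PMF.toOuterMeasure_map_apply, PMF.toOuterMeasure_apply_eq_one_iff]
    intro p hp
    obtain ⟨hcard, hcl⟩ := mem_support_plantedCliqueJoint hp
    have hle : 3 * (natE n).length ≤ p.1.card := by
      rw [hcard]
      exact le_min hk hnn
    obtain ⟨S, hSsub, hScard⟩ := Finset.exists_subset_card_eq hle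
    exact ⟨S, hScard, hcl.subset (by exact_mod_cast hSsub)⟩
  -- contradiction with detection hardness at `ε = 1/4`
  refine hD (1 / 4) (by norm_num) T hTpoly ?_
  have heq : (fun n => typeIError T n + typeIIError T (fun n => ⌈(n : ℝ) ^ (1 / 2 - 1 / 4 : ℝ)⌉₊) n) =ᶠ[atTop]
      fun n => typeIError T n := h2.mono fun n hn => by beta_reduce; rw [hn, add_zero]
  exact h1.congr' heq.symm

end Summit.PneNP.PneNP.Theorems
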